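import Mathlib
import Summits.CriticalPhenomena.Ising3DConformalLimit.Theorems.MoebiusLimitOfTwoPointLaw.Negative.GroupLemmaNeedsTranslation
import Summits.CriticalPhenomena.Ising3DConformalLimit.Theorems.PrecisionLaplacianMoebiusLimitOfTwoPointLawSphereInversionCoV
import HarnessLib

/-!
# Moment densities of a sphere-inversion-reversible law are sphere-inversion covariant
(stub K2b `stub_densityOfLawReversal` of line `two-shell-exchange-markov`, crux `MoebiusLimitOfTwoPointLaw`,
item stmt-CriticalPhenomena-4801)

Pure analysis on `CorrFamily 3`, no probability. Write `ι_λ x = (λ/‖x‖²) x` for the origin-centred sphere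
inversion and `Φ x = (ι_λ xᵢ)ᵢ` for its product action on configurations. If `S` is continuous on `NonCoincident`,
vanishes off it, and the smeared identity `∫ S_n(x) ∏ᵢ (λ/‖xᵢ‖²)^{3−Δ} fᵢ(ι_λ xᵢ) dx = ∫ S_n(x) ∏ᵢ fᵢ(xᵢ) dx`
holds for all smooth test functions compactly supported off the origin with pairwise disjoint supports, then
`S ∈ Negative.sphereInversionCovariant Δ` pointwise (`stub_densityOfLawReversal`). Route:
* the change of variables `y = Φ x` of the companion file `…SphereInversionCoV` (`integral_sphereInversion_transfer`)
  turns the identity into `∫ H(x) ∏ᵢ fᵢ(xᵢ) dx = 0` with `H(x) = S_n(Φ x) ∏ᵢ (λ/‖xᵢ‖²)^Δ − S_n(x)`;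
* `eq_zero_of_integral_mul_prod_bump`: the fundamental lemma of the calculus of variations with PRODUCT bump
  functions (`ContDiffBump` in each coordinate, small radii) gives `H = 0` at every non-coincident off-origin
  configuration (`apply_prodSphereInversion_mul_eq`: product bumps centred there are admissible test families);
  off `NonCoincident` both sides of the covariance identity vanish (`ι_λ` is injective).

References: Di Francesco–Mathieu–Sénéchal, *Conformal Field Theory* (1997) §4.3.1 (4.48)
[FrancescoMathieuSenechal1997]; Hörmander, *ALPDO I*, Thm 1.2.5 (fundamental lemma) [HormanderALPDO1].
-/

noncomputable section

namespace Summit.CriticalPhenomena.Ising3DConformalLimit.PrecisionLaplacianMoebiusLimitOfTwoPointLaw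

open Literature.Probability.LatticeModels Filter Topology MeasureTheory
open Summit.CriticalPhenomena.Ising3DConformalLimit.Theorems.MoebiusLimitOfTwoPointLaw.Negative
  (sphereInversionCovariant sphereInversion_injective)

/-! ## The fundamental lemma with product bump functions -/

/-- A function continuous on an open set `V`, cut off by a continuous compactly supported `φ` with
`tsupport φ ⊆ V`, is integrable. -/
theorem integrable_mul_of_continuousOn {X : Type*} [MeasurableSpace X] [TopologicalSpace X]
    [OpensMeasurableSpace X] {μ : Measure X} [IsFiniteMeasureOnCompacts μ] {g φ : X → ℝ}
    {V : Set X} (hg : ContinuousOn g V) (hV : IsOpen V) (hφ : Continuous φ)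
    (hφc : HasCompactSupport φ) (hφV : tsupport φ ⊆ V) :
    Integrable (fun x => g x * φ x) μ := by
  have hc : Continuous fun x => g x * φ x := by
    refine continuous_iff_continuousAt.2 fun x => ?_
    by_cases hx : x ∈ V
    · exact (hg.continuousAt (hV.mem_nhds hx)).mul hφ.continuousAt
    · have h0 : φ =ᶠ[𝓝 x] 0 := notMem_tsupport_iff_eventuallyEq.1 fun h => hx (hφV h)
      have h1 : (fun x => g x * φ x) =ᶠ[𝓝 x] fun _ => (0 : ℝ) :=
        h0.mono fun y hy => by simp [hy]
      exact h1.continuousAt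
  exact hc.integrable_of_hasCompactSupport hφc.mul_left

/-- **Fundamental lemma with product bumps.** If `H` is continuous at `x₀` and `∫ H(y) ∏ᵢ bᵢ(yᵢ) dy = 0`
for every family of bump functions `bᵢ` centred at `x₀ i` with outer radii `< ε`, then `H x₀ = 0`
(otherwise `|∫ H ∏ b| ≥ (|H x₀|/2) ∏ᵢ ∫ bᵢ > 0` for small radii). -/
theorem eq_zero_of_integral_mul_prod_bump {n : ℕ} {x₀ : Fin n → EuclideanSpace ℝ (Fin 3)}
    {H : (Fin n → EuclideanSpace ℝ (Fin 3)) → ℝ} {ε : ℝ} (hε : 0 < ε) (hH : ContinuousAt H x₀)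
    (h : ∀ b : (i : Fin n) → ContDiffBump (x₀ i), (∀ i, (b i).rOut < ε) →
      Integrable (fun y : Fin n → EuclideanSpace ℝ (Fin 3) => H y * ∏ i, b i (y i)) ∧
        ∫ y : Fin n → EuclideanSpace ℝ (Fin 3), H y * ∏ i, b i (y i) = 0) :
    H x₀ = 0 := by
  by_contra hne
  have hδ : 0 < |H x₀| / 2 := by positivity
  obtain ⟨η, hη, hηH⟩ := Metric.continuousAt_iff.1 hH (|H x₀| / 2) hδ
  obtain ⟨r, hr0, hrε, hrη⟩ : ∃ r, 0 < r ∧ r < ε ∧ r < η :=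
    ⟨min (ε / 2) (η / 2), lt_min (half_pos hε) (half_pos hη),
      (min_le_left _ _).trans_lt (half_lt_self hε), (min_le_right _ _).trans_lt (half_lt_self hη)⟩
  let b : (i : Fin n) → ContDiffBump (x₀ i) := fun i => ⟨r / 2, r, half_pos hr0, half_lt_self hr0⟩
  obtain ⟨hint, hzero⟩ := h b fun _ => hrε
  have hPnn : ∀ y : Fin n → EuclideanSpace ℝ (Fin 3), 0 ≤ ∏ i, b i (y i) := fun y =>
    Finset.prod_nonneg fun i _ => (b i).nonneg
  have hPsupp : ∀ y : Fin n → EuclideanSpace ℝ (Fin 3), (∏ i, b i (y i)) ≠ 0 → dist y x₀ < r := by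
    refine fun y hy => (dist_pi_lt_iff hr0).2 fun i => ?_
    have hi : y i ∈ Function.support (b i) := (Finset.prod_ne_zero_iff.1 hy) i (Finset.mem_univ i)
    rwa [ContDiffBump.support_eq] at hi
  have hPcont : Continuous fun y : Fin n → EuclideanSpace ℝ (Fin 3) => ∏ i, b i (y i) :=
    continuous_finsetProd _ fun i _ => (b i).continuous.comp (continuous_apply i)
  have hPcs : HasCompactSupport fun y : Fin n → EuclideanSpace ℝ (Fin 3) => ∏ i, b i (y i) :=
    HasCompactSupport.intro (isCompact_closedBall x₀ r) fun y hy =>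
      by_contra fun hne' => hy (Metric.mem_closedBall.2 (hPsupp y hne').le)
  have hPint : Integrable (fun y : Fin n → EuclideanSpace ℝ (Fin 3) => ∏ i, b i (y i)) :=
    hPcont.integrable_of_hasCompactSupport hPcs
  have hPpos : 0 < ∫ y : Fin n → EuclideanSpace ℝ (Fin 3), ∏ i, b i (y i) := by
    rw [integral_fintype_prod_volume_eq_prod (fun i => (b i : EuclideanSpace ℝ (Fin 3) → ℝ))]
    exact Finset.prod_pos fun i _ => (b i).integral_pos
  have hclose : ∀ y : Fin n → EuclideanSpace ℝ (Fin 3), (∏ i, b i (y i)) ≠ 0 →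
      |H y - H x₀| < |H x₀| / 2 := fun y hy => by
    have := hηH ((hPsupp y hy).trans hrη); rwa [Real.dist_eq] at this
  rcases lt_or_gt_of_ne hne with hneg | hpos
  · have hle : ∀ y : Fin n → EuclideanSpace ℝ (Fin 3),
        H y * ∏ i, b i (y i) ≤ (H x₀ / 2) * ∏ i, b i (y i) := by
      intro y
      by_cases hy : (∏ i, b i (y i)) = 0
      · simp [hy]
      · refine mul_le_mul_of_nonneg_right ?_ (hPnn y)
        have h1 := hclose y hy
        rw [abs_of_neg hneg] at h1
        linarith [(abs_lt.1 h1).2]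
    have h2 := integral_mono hint (hPint.const_mul (H x₀ / 2)) hle
    rw [hzero, integral_const_mul] at h2
    have h3 : (H x₀ / 2) * ∫ y : Fin n → EuclideanSpace ℝ (Fin 3), ∏ i, b i (y i) < 0 :=
      mul_neg_of_neg_of_pos (by linarith) hPpos
    linarith
  · have hle : ∀ y : Fin n → EuclideanSpace ℝ (Fin 3),
        (H x₀ / 2) * ∏ i, b i (y i) ≤ H y * ∏ i, b i (y i) := by
      intro y
      by_cases hy : (∏ i, b i (y i)) = 0
      · simp [hy]
      · refine mul_le_mul_of_nonneg_right ?_ (hPnn y)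
        have h1 := hclose y hy
        rw [abs_of_pos hpos] at h1
        linarith [(abs_lt.1 h1).1]
    have h2 := integral_mono (hPint.const_mul (H x₀ / 2)) hint hle
    rw [hzero, integral_const_mul] at h2
    have h3 : 0 < (H x₀ / 2) * ∫ y : Fin n → EuclideanSpace ℝ (Fin 3), ∏ i, b i (y i) :=
      mul_pos (by linarith) hPpos
    linarith

/-! ## Pointwise covariance -/

/-- The transformed density `y ↦ S_n(Φ y) ∏ᵢ (λ/‖yᵢ‖²)^Δ` is continuous on the open set of non-coincident
off-origin configurations (`Φ` preserves it). -/
theorem continuousOn_sphereInversionTransform {S : CorrFamily 3} {n : ℕ}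
    (hcont : ContinuousOn (S n) (NonCoincident 3 n)) {lam : ℝ} (hlam : 0 < lam) (Δ : ℝ) :
    ContinuousOn (fun y : Fin n → EuclideanSpace ℝ (Fin 3) => S n (fun i => (lam / ‖y i‖ ^ 2) • y i) *
      ∏ i, (lam / ‖y i‖ ^ 2) ^ Δ) (NonCoincident 3 n ∩ {y | ∀ i, y i ≠ 0}) := by
  have hcoef : ∀ i : Fin n, ContinuousOn (fun y : Fin n → EuclideanSpace ℝ (Fin 3) => lam / ‖y i‖ ^ 2)
      (NonCoincident 3 n ∩ {y | ∀ i, y i ≠ 0}) := fun i =>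
    continuousOn_const.div (by fun_prop) fun y hy => pow_ne_zero 2 (norm_ne_zero_iff.2 (hy.2 i))
  refine ContinuousOn.mul ?_ (continuousOn_finsetProd _ fun i _ => (hcoef i).rpow_const fun y hy =>
    Or.inl (div_ne_zero hlam.ne' (pow_ne_zero 2 (norm_ne_zero_iff.2 (hy.2 i)))))
  refine hcont.comp (continuousOn_pi.2 fun i => (hcoef i).smul (continuous_apply i).continuousOn) ?_
  intro y hy
  exact fun i j hij => hy.1 (sphereInversion_injective hlam.ne' hij)

/-- **Pointwise covariance from the transferred identity.** If `∫ (S_n(Φ x) ∏ᵢ (λ/‖xᵢ‖²)^Δ) ∏ᵢ fᵢ(xᵢ) dx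
= ∫ S_n(x) ∏ᵢ fᵢ(xᵢ) dx` for all admissible test families, then `S_n(Φ x) ∏ᵢ (λ/‖xᵢ‖²)^Δ = S_n(x)` at every
non-coincident off-origin `x` (product bumps centred at `x` with small radii are admissible). -/
theorem apply_prodSphereInversion_mul_eq {Δ : ℝ} {S : CorrFamily 3} {n : ℕ}
    (hcont : ContinuousOn (S n) (NonCoincident 3 n)) {lam : ℝ} (hlam : 0 < lam)
    (hid : ∀ f : Fin n → EuclideanSpace ℝ (Fin 3) → ℝ,
      (∀ i, ContDiff ℝ ((⊤ : ℕ∞) : WithTop ℕ∞) (f i) ∧ HasCompactSupport (f i) ∧ tsupport (f i) ⊆ {0}ᶜ) →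
      (∀ i j, i ≠ j → Disjoint (tsupport (f i)) (tsupport (f j))) →
      ∫ x : Fin n → EuclideanSpace ℝ (Fin 3),
          (S n (fun i => (lam / ‖x i‖ ^ 2) • x i) * ∏ i, (lam / ‖x i‖ ^ 2) ^ Δ) * ∏ i, f i (x i) =
        ∫ x : Fin n → EuclideanSpace ℝ (Fin 3), S n x * ∏ i, f i (x i))
    {x : Fin n → EuclideanSpace ℝ (Fin 3)} (hx : ∀ i, x i ≠ 0) (hinj : Function.Injective x) :
    S n (fun i => (lam / ‖x i‖ ^ 2) • x i) * ∏ i, (lam / ‖x i‖ ^ 2) ^ Δ = S n x := by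
  have hW := (isOpen_nonCoincident 3 n).inter (isOpen_forall_ne_zero n)
  have hxW : x ∈ NonCoincident 3 n ∩ {y : Fin n → EuclideanSpace ℝ (Fin 3) | ∀ i, y i ≠ 0} := ⟨hinj, hx⟩
  obtain ⟨ε, hε, hball⟩ := Metric.isOpen_iff.1 hW x hxW
  have hA := continuousOn_sphereInversionTransform hcont hlam Δ
  have hS : ContinuousOn (S n) (NonCoincident 3 n ∩ {y : Fin n → EuclideanSpace ℝ (Fin 3) | ∀ i, y i ≠ 0}) :=
    hcont.mono Set.inter_subset_left
  refine sub_eq_zero.1 (eq_zero_of_integral_mul_prod_bump hε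
    ((hA.sub hS).continuousAt (hW.mem_nhds hxW)) fun b hb => ?_)
  -- points of the `ε`-ball around `x`, built by updating coordinates of `x`
  have hupd : ∀ (i : Fin n) (p : EuclideanSpace ℝ (Fin 3)), dist p (x i) < ε →
      ∀ y : Fin n → EuclideanSpace ℝ (Fin 3), dist y x < ε → dist (Function.update y i p) x < ε := by
    intro i p hp y hy
    rw [dist_pi_lt_iff hε] at hy ⊢
    refine fun k => if hk : k = i then ?_ else ?_
    · subst hk; rwa [Function.update_self]
    · rw [Function.update_of_ne hk]; exact hy k
  have hx0 : dist x x < ε := by rwa [dist_self]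
  -- admissibility of the bump family
  have hadm : ∀ i, ContDiff ℝ ((⊤ : ℕ∞) : WithTop ℕ∞) (b i) ∧ HasCompactSupport (b i) ∧
      tsupport (b i) ⊆ {0}ᶜ := by
    refine fun i => ⟨(b i).contDiff, (b i).hasCompactSupport, ?_⟩
    rw [(b i).tsupport_eq]
    intro p hp hp0
    have hp' : dist p (x i) < ε := (Metric.mem_closedBall.1 hp).trans_lt (hb i)
    have hy := hball (Metric.mem_ball.2 (hupd i p hp' x hx0))
    exact hy.2 i (by rw [Function.update_self]; exact hp0)
  have hdisj : ∀ i j, i ≠ j → Disjoint (tsupport (b i)) (tsupport (b j)) := by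
    intro i j hij
    rw [(b i).tsupport_eq, (b j).tsupport_eq, Set.disjoint_left]
    intro p hpi hpj
    have hpi' : dist p (x i) < ε := (Metric.mem_closedBall.1 hpi).trans_lt (hb i)
    have hpj' : dist p (x j) < ε := (Metric.mem_closedBall.1 hpj).trans_lt (hb j)
    have hy := hball (Metric.mem_ball.2 (hupd j p hpj' _ (hupd i p hpi' x hx0)))
    refine hij (hy.1 ?_)
    rw [Function.update_of_ne hij, Function.update_self, Function.update_self]
  have hI := hid (fun i => b i) hadm hdisj
  -- the product bump: continuous, compactly supported inside `W`
  have hK0 : ∀ y : Fin n → EuclideanSpace ℝ (Fin 3), (∏ i, b i (y i)) ≠ 0 →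
      y ∈ Set.pi Set.univ fun i => Metric.closedBall (x i) (b i).rOut := by
    intro y hy i _
    have hi : y i ∈ Function.support (b i) := (Finset.prod_ne_zero_iff.1 hy) i (Finset.mem_univ i)
    rw [ContDiffBump.support_eq] at hi
    exact Metric.ball_subset_closedBall hi
  have hKW : (Set.pi Set.univ fun i => Metric.closedBall (x i) (b i).rOut) ⊆
      NonCoincident 3 n ∩ {y : Fin n → EuclideanSpace ℝ (Fin 3) | ∀ i, y i ≠ 0} := fun y hy =>
    hball (Metric.mem_ball.2 ((dist_pi_lt_iff hε).2 fun i =>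
      (Metric.mem_closedBall.1 (hy i (Set.mem_univ i))).trans_lt (hb i)))
  have hPc : Continuous fun y : Fin n → EuclideanSpace ℝ (Fin 3) => ∏ i, b i (y i) :=
    continuous_finsetProd _ fun i _ => (b i).continuous.comp (continuous_apply i)
  have hPcs : HasCompactSupport fun y : Fin n → EuclideanSpace ℝ (Fin 3) => ∏ i, b i (y i) :=
    HasCompactSupport.intro (isCompact_univ_pi fun i => isCompact_closedBall (x i) (b i).rOut)
      fun y hy => by_contra fun h => hy (hK0 y h)
  have htsP : tsupport (fun y : Fin n → EuclideanSpace ℝ (Fin 3) => ∏ i, b i (y i)) ⊆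
      NonCoincident 3 n ∩ {y : Fin n → EuclideanSpace ℝ (Fin 3) | ∀ i, y i ≠ 0} :=
    (closure_minimal (fun y hy => hK0 y hy) (isClosed_set_pi fun i _ => Metric.isClosed_closedBall)).trans
      hKW
  have hintA := integrable_mul_of_continuousOn (μ := volume) hA hW hPc hPcs htsP
  have hintS := integrable_mul_of_continuousOn (μ := volume) hS hW hPc hPcs htsP
  refine ⟨?_, ?_⟩
  · simp_rw [Pi.sub_apply, sub_mul]; exact hintA.sub hintS
  · simp_rw [Pi.sub_apply, sub_mul]; rw [integral_sub hintA hintS, sub_eq_zero]; exact hI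

/-- **Stub K2b (`stub_densityOfLawReversal`) — moment densities of a sphere-inversion-reversible law are
sphere-inversion covariant.** If `S : CorrFamily 3` is continuous on `NonCoincident`, vanishes off it, and
satisfies the smeared reversibility identity `∫ S_n(x) ∏ᵢ (λ/‖xᵢ‖²)^{3−Δ} fᵢ(ι_λ xᵢ) dx = ∫ S_n(x) ∏ᵢ fᵢ(xᵢ) dx`
for all smooth test functions compactly supported off the origin with pairwise disjoint supports, then
`S_n(ι_λ x) = λ^{−nΔ} ∏ᵢ ‖xᵢ‖^{2Δ} S_n(x)` at every off-origin configuration, i.e.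
`S ∈ Negative.sphereInversionCovariant Δ`. [FrancescoMathieuSenechal1997 §4.3.1 (4.48); HormanderALPDO1
Thm 1.2.5] -/
theorem stub_densityOfLawReversal :
    ∀ (Δ : ℝ) (S : CorrFamily 3), (∀ n, ContinuousOn (S n) (NonCoincident 3 n)) →
      (∀ n z, z ∉ NonCoincident 3 n → S n z = 0) →
      (∀ (n : ℕ) (lam : ℝ), 0 < lam → ∀ (f : Fin n → EuclideanSpace ℝ (Fin 3) → ℝ),
        (∀ i, ContDiff ℝ ((⊤ : ℕ∞) : WithTop ℕ∞) (f i) ∧ HasCompactSupport (f i) ∧ tsupport (f i) ⊆ {0}ᶜ) →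
        (∀ i j, i ≠ j → Disjoint (tsupport (f i)) (tsupport (f j))) →
        (∫ x : Fin n → EuclideanSpace ℝ (Fin 3),
            S n x * ∏ i, ((lam / ‖x i‖ ^ 2) ^ ((3 : ℝ) - Δ) * f i ((lam / ‖x i‖ ^ 2) • x i))) =
          ∫ x : Fin n → EuclideanSpace ℝ (Fin 3), S n x * ∏ i, f i (x i)) →
      S ∈ sphereInversionCovariant Δ := by
  intro Δ S hcont hnorm hyp n lam hlam x hx
  by_cases hinj : Function.Injective x
  · have key : S n (fun i => (lam / ‖x i‖ ^ 2) • x i) * ∏ i, (lam / ‖x i‖ ^ 2) ^ Δ = S n x := by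
      refine apply_prodSphereInversion_mul_eq (hcont n) hlam (fun f hf hdisj => ?_) hx hinj
      rw [← integral_sphereInversion_transfer n lam hlam Δ (S n) f fun i =>
        image_eq_zero_of_notMem_tsupport fun h => (hf i).2.2 h rfl]
      exact hyp n lam hlam f hf hdisj
    have hc : (∏ i, ‖x i‖ ^ (2 * Δ)) * ∏ i, (lam / ‖x i‖ ^ 2) ^ Δ = lam ^ ((n : ℝ) * Δ) := by
      rw [← Finset.prod_mul_distrib]
      rw [Finset.prod_congr rfl fun i _ =>
        (show ‖x i‖ ^ (2 * Δ) * (lam / ‖x i‖ ^ 2) ^ Δ = lam ^ Δ from by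
          have hn : 0 < ‖x i‖ := norm_pos_iff.2 (hx i)
          rw [Real.rpow_mul (norm_nonneg _), Real.rpow_two, ← Real.mul_rpow (by positivity)
            (by positivity), mul_div_cancel₀ _ (by positivity)])]
      rw [Finset.prod_const, Finset.card_univ, Fintype.card_fin, ← Real.rpow_mul_natCast hlam.le,
        mul_comm]
    calc S n (fun i => (lam / ‖x i‖ ^ 2) • x i)
        = lam ^ (-(n : ℝ) * Δ) * lam ^ ((n : ℝ) * Δ) * S n (fun i => (lam / ‖x i‖ ^ 2) • x i) := by
          rw [← Real.rpow_add hlam, neg_mul, neg_add_cancel, Real.rpow_zero, one_mul]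
      _ = lam ^ (-(n : ℝ) * Δ) * (∏ i, ‖x i‖ ^ (2 * Δ)) *
            (S n (fun i => (lam / ‖x i‖ ^ 2) • x i) * ∏ i, (lam / ‖x i‖ ^ 2) ^ Δ) := by
          rw [← hc]; ring
      _ = lam ^ (-(n : ℝ) * Δ) * (∏ i, ‖x i‖ ^ (2 * Δ)) * S n x := by rw [key]
  · have h2 : (fun i => (lam / ‖x i‖ ^ 2) • x i) ∉ NonCoincident 3 n := by
      intro h
      exact hinj fun i j hij => h (show (lam / ‖x i‖ ^ 2) • x i = (lam / ‖x j‖ ^ 2) • x j by rw [hij])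
    rw [hnorm n x hinj, hnorm n _ h2, mul_zero]

end Summit.CriticalPhenomena.Ising3DConformalLimit.PrecisionLaplacianMoebiusLimitOfTwoPointLaw
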